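import Literature.AlgebraicGeometry.Frobenioids.ArchimedeanProp35iiiStdProps
import Literature.AlgebraicGeometry.Frobenioids.ArchimedeanTheoremsInstances
import Mathlib.Data.Fintype.EquivFin
import HarnessLib

/-!
# The four-object base `S → D₀` is of RC-STANDARD type ([FrdII] Def. 3.1 (v))

Mochizuki, *The geometry of Frobenioids II: poly-Frobenioids*, Kyushu J. Math. **62** (2008) 401–460, §3,
Definition 3.1 (v) p. 25: "`F` is of RC-standard type if `F` is: (a) RC-connected; (b) complexifiable; (c) of
FSMFF-type; (d) of RC-iso-subanchor type" [cite: MochizukiFrdII2008, Def 3.1 (v) p.25]; [FrdI] §0 p. 18 (anchors)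
[cite: MochizukiFrdI2008, §0 p.18].

PROOF-ONLY companion of `ArchimedeanProp35iiiStdBase.lean` / `…StdProps.lean` (abc-iut cell, layer L1, node
`FrdII:Prop3.5(iii)`, sub-row P35iii-STD; seat abc-iut-w4-d027 gen 3). PROVED:
* `isAnchor_of_finite` — in a category with finitely many objects and finite hom-sets every object is an anchor
  ([FrdI] §0: the isomorphism classes of the coslice category are already finite) — a general lemma;
* for `π = toD0`: `a` is the only real object, `b`, `c`, `d` are complex RC-anchors (`S` is finite), `a` is an
  RC-iso-subanchor through the mono-minimal quotient `f : b → a` by `Aut(b)`, so `S` is of RC-iso-subanchor type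
  (`isOfRCIsoSubanchorType`); `S` is complexifiable (`β ∈ Aut(c)` over `h : c → a` maps to complex conjugation),
  of FSMFF-type (it is of FSM-type), RC-connected (`S[ℝ] = {a}`; `S[ℂ] = {b, c, d}` is connected through `d`);
  hence **`isOfRCStandardType : RC.IsOfRCStandardType (baseRC toD0)`** — ALL the standing hypotheses on the base
  `D` in [FrdII] Thm. 3.6 / Cor. 4.2 (v), although the base functor kills `Aut(b)`.
No definitions; nothing here bears on [IUTchIII] Cor. 3.12.
-/

namespace Literature.AlgebraicGeometry.Frobenioids

open CategoryTheory

noncomputable section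

universe v u

/-! ### Anchors in finite categories -/

/-- **In a category with finitely many objects and finite hom-sets, every object is an anchor** ([FrdI] §0): the
coslice category `^A C` has finitely many objects, so finitely many isomorphism classes arise from (irreducible)
arrows out of `A`. [cite: MochizukiFrdI2008, §0 p.18] -/
theorem isAnchor_of_finite {C : Type u} [Category.{v} C] [Finite C] [hf : ∀ X Y : C, Finite (X ⟶ Y)] (A : C) :
    IsAnchor A := by
  haveI : Finite (Under A) :=
    Finite.of_surjective (fun p : Σ X : C, (A ⟶ X) => Under.mk p.2) fun f =>
      ⟨⟨f.right, f.hom⟩, (StructuredArrow.eq_mk f).symm⟩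
  exact Set.toFinite _

namespace ArchFrd

namespace P35iiiStd

open S

/-! ### Finiteness of `S` -/

/-- `S` has finitely many (four) objects. [cite: MochizukiFrdII2008, Prop 3.5 (iii) p.34] -/
theorem finite_S : Finite S :=
  Finite.of_surjective (fun i : Fin 4 => ([a, b, c, d] : List S).getD i a) fun X => by
    cases X
    · exact ⟨0, rfl⟩
    · exact ⟨1, rfl⟩
    · exact ⟨2, rfl⟩
    · exact ⟨3, rfl⟩

/-- `S` has finite hom-sets. [cite: MochizukiFrdII2008, Prop 3.5 (iii) p.34] -/
theorem finite_hom (X Y : S) : Finite (X ⟶ Y) := by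
  cases X <;> cases Y
  · exact Finite.of_subsingleton
  · exact Finite.of_subsingleton
  · exact Finite.of_subsingleton
  · exact Finite.of_subsingleton
  · exact Finite.of_subsingleton
  · exact Finite.of_surjective au fun φ => by obtain ⟨s, rfl⟩ := hom_bb_eq φ; exact ⟨s, rfl⟩
  · exact Finite.of_subsingleton
  · exact Finite.of_subsingleton
  · exact Finite.of_surjective hHom fun φ => by obtain ⟨k, rfl⟩ := hom_ca_eq φ; exact ⟨k, rfl⟩
  · exact Finite.of_subsingleton
  · exact Finite.of_surjective cu fun φ => by obtain ⟨t, rfl⟩ := hom_cc_eq φ; exact ⟨t, rfl⟩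
  · exact Finite.of_subsingleton
  · refine Finite.of_surjective (fun ρ : Option Bool => (Hom.r (ρ.elim R.pf R.qh) : d ⟶ a)) fun φ => ?_
    cases φ with
    | r ρ =>
      cases ρ with
      | pf => exact ⟨none, rfl⟩
      | qh k => exact ⟨some k, rfl⟩
  · exact Finite.of_surjective pHom fun φ => by obtain ⟨s, rfl⟩ := hom_db_eq φ; exact ⟨s, rfl⟩
  · exact Finite.of_surjective qHom fun φ => by obtain ⟨t, rfl⟩ := hom_dc_eq φ; exact ⟨t, rfl⟩
  · exact Finite.of_subsingleton

/-! ### Real and complex objects for `π = toD0` -/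

/-- `a` is a real object. [cite: MochizukiFrdII2008, Def 3.1 (v) p.24] -/
theorem realObjects_a : RC.realObjects (baseRC Literature.AlgebraicGeometry.Frobenioids.ArchFrd.P35iiiStd.toD0) a := (D0.realObjects_comp_iff Literature.AlgebraicGeometry.Frobenioids.ArchFrd.P35iiiStd.toD0 a).mpr rfl

/-- `b` is a complex object. [cite: MochizukiFrdII2008, Def 3.1 (v) p.24] -/
theorem complexObjects_b : RC.complexObjects (baseRC Literature.AlgebraicGeometry.Frobenioids.ArchFrd.P35iiiStd.toD0) b := (D0.complexObjects_comp_iff Literature.AlgebraicGeometry.Frobenioids.ArchFrd.P35iiiStd.toD0 b).mpr rfl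

/-- `c` is a complex object. [cite: MochizukiFrdII2008, Def 3.1 (v) p.24] -/
theorem complexObjects_c : RC.complexObjects (baseRC Literature.AlgebraicGeometry.Frobenioids.ArchFrd.P35iiiStd.toD0) c := (D0.complexObjects_comp_iff Literature.AlgebraicGeometry.Frobenioids.ArchFrd.P35iiiStd.toD0 c).mpr rfl

/-- `d` is a complex object. [cite: MochizukiFrdII2008, Def 3.1 (v) p.24] -/
theorem complexObjects_d : RC.complexObjects (baseRC Literature.AlgebraicGeometry.Frobenioids.ArchFrd.P35iiiStd.toD0) d := (D0.complexObjects_comp_iff Literature.AlgebraicGeometry.Frobenioids.ArchFrd.P35iiiStd.toD0 d).mpr rfl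

/-- `a` is not complex. [cite: MochizukiFrdII2008, Def 3.1 (v) p.24] -/
theorem not_complexObjects_a : ¬ RC.complexObjects (baseRC Literature.AlgebraicGeometry.Frobenioids.ArchFrd.P35iiiStd.toD0) a := fun h => by
  have h1 : D0.real = D0.complex := (D0.complexObjects_comp_iff Literature.AlgebraicGeometry.Frobenioids.ArchFrd.P35iiiStd.toD0 a).mp h
  cases h1

/-- The only real object is `a`. [cite: MochizukiFrdII2008, Def 3.1 (v) p.24] -/
theorem eq_a_of_realObjects {X : S} (h : RC.realObjects (baseRC Literature.AlgebraicGeometry.Frobenioids.ArchFrd.P35iiiStd.toD0) X) : X = a := by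
  have h1 : Literature.AlgebraicGeometry.Frobenioids.ArchFrd.P35iiiStd.toD0.obj X = D0.real := (D0.realObjects_comp_iff Literature.AlgebraicGeometry.Frobenioids.ArchFrd.P35iiiStd.toD0 X).mp h
  cases X
  · rfl
  all_goals cases h1

/-! ### Anchors, subanchors, iso-subanchors -/

/-- Every complex object of `S` is an RC-anchor: `S[ℂ]` is a finite category.
[cite: MochizukiFrdII2008, Def 3.1 (v) p.25] -/
theorem isRCAnchor_of_complexObjects {X : S} (hX : RC.complexObjects (baseRC Literature.AlgebraicGeometry.Frobenioids.ArchFrd.P35iiiStd.toD0) X) :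
    RC.IsRCAnchor (baseRC Literature.AlgebraicGeometry.Frobenioids.ArchFrd.P35iiiStd.toD0) X := by
  refine ⟨hX, ?_⟩
  haveI : Finite S := finite_S
  haveI : Finite (RC.ComplexPart (baseRC Literature.AlgebraicGeometry.Frobenioids.ArchFrd.P35iiiStd.toD0)) :=
    Finite.of_injective (fun Y : RC.ComplexPart (baseRC Literature.AlgebraicGeometry.Frobenioids.ArchFrd.P35iiiStd.toD0) => Y.obj) fun Y Z h => by
      cases Y; cases Z; cases h; rfl
  haveI : ∀ Y Z : RC.ComplexPart (baseRC Literature.AlgebraicGeometry.Frobenioids.ArchFrd.P35iiiStd.toD0), Finite (Y ⟶ Z) := fun Y Z => by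
    haveI : Finite (Y.obj ⟶ Z.obj) := finite_hom _ _
    exact Finite.of_injective (fun φ : Y ⟶ Z => φ.hom) fun φ ψ h => InducedCategory.hom_ext h
  exact isAnchor_of_finite _

/-- Every complex object of `S` is an RC-subanchor. [cite: MochizukiFrdII2008, Def 3.1 (v) p.25] -/
theorem isRCSubanchor_of_complexObjects {X : S} (hX : RC.complexObjects (baseRC Literature.AlgebraicGeometry.Frobenioids.ArchFrd.P35iiiStd.toD0) X) :
    RC.IsRCSubanchor (baseRC Literature.AlgebraicGeometry.Frobenioids.ArchFrd.P35iiiStd.toD0) X :=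
  ⟨X, isRCAnchor_of_complexObjects hX, ⟨𝟙 X⟩⟩

/-- Every complex object of `S` is an RC-iso-subanchor (identity quotient by the trivial group, [FrdI] §0).
[cite: MochizukiFrdII2008, Def 3.1 (v) p.25] -/
theorem isRCIsoSubanchor_of_complexObjects {X : S} (hX : RC.complexObjects (baseRC Literature.AlgebraicGeometry.Frobenioids.ArchFrd.P35iiiStd.toD0) X) :
    RC.IsRCIsoSubanchor (baseRC Literature.AlgebraicGeometry.Frobenioids.ArchFrd.P35iiiStd.toD0) X :=
  ⟨X, ⊥, 𝟙 X, isRCSubanchor_of_complexObjects hX, isTotallyEpimorphic.isMonoMinimalQuotient_bot_of_isIso (𝟙 X)⟩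

/-- **The real object `a` is an RC-iso-subanchor**: `f : b → a` is a mono-minimal categorical quotient of the
RC-anchor `b` by `Aut(b)` — a group the base functor KILLS. [cite: MochizukiFrdII2008, Def 3.1 (v) p.25] -/
theorem isRCIsoSubanchor_a : RC.IsRCIsoSubanchor (baseRC Literature.AlgebraicGeometry.Frobenioids.ArchFrd.P35iiiStd.toD0) a :=
  ⟨b, ⊤, fHom, isRCSubanchor_of_complexObjects complexObjects_b, isMonoMinimalQuotient_fHom⟩

/-- **`S` is of RC-iso-subanchor type for `π = toD0`** — the only hypothesis of the typed Prop. 3.5 (iii).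
[cite: MochizukiFrdII2008, Def 3.1 (v) p.25] -/
theorem isOfRCIsoSubanchorType : RC.IsOfRCIsoSubanchorType (baseRC Literature.AlgebraicGeometry.Frobenioids.ArchFrd.P35iiiStd.toD0) :=
  ⟨fun X => by
    cases X
    · exact isRCIsoSubanchor_a
    · exact isRCIsoSubanchor_of_complexObjects complexObjects_b
    · exact isRCIsoSubanchor_of_complexObjects complexObjects_c
    · exact isRCIsoSubanchor_of_complexObjects complexObjects_d⟩

/-! ### The other clauses of RC-standard type -/

/-- **`S` is complexifiable**: over the real object `a` lies the complex object `c` via `h : c → a`, and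
`β ∈ Aut(c)` fixes `h` and maps to complex conjugation. [cite: MochizukiFrdII2008, Def 3.1 (v) p.25] -/
theorem isComplexifiable : RC.IsComplexifiable (baseRC Literature.AlgebraicGeometry.Frobenioids.ArchFrd.P35iiiStd.toD0) := by
  refine ⟨fun X hX => ?_⟩
  obtain rfl := eq_a_of_realObjects hX
  refine ⟨c, hHom false, beta, complexObjects_c, rfl, ?_⟩
  haveI : D0.toArchBase.Faithful := D0.toArchBase_faithful
  change D0.toArchBase.map D0.conj ≠ 𝟙 (D0.toArchBase.obj D0.complex)
  rw [← D0.toArchBase.map_id]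
  exact fun h => D0.conj_ne_id (D0.toArchBase.map_injective h)

/-- `S` is of FSMFF-type (it is of FSM-type). [cite: MochizukiFrdI2008, §0 p.18] -/
theorem isOfFSMFFType : IsOfFSMFFType Literature.AlgebraicGeometry.Frobenioids.ArchFrd.P35iiiStd.S := isOfFSMType.isOfFSMFFType

/-- **`S` is RC-connected**: connected, `S[ℝ] = {a}` connected, `S[ℂ] = {b, c, d}` connected through `d`.
[cite: MochizukiFrdII2008, Def 3.1 (v) p.25] -/
theorem isRCConnected : RC.IsRCConnected (baseRC Literature.AlgebraicGeometry.Frobenioids.ArchFrd.P35iiiStd.toD0) := by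
  refine ⟨isConnected, Or.inr ?_, Or.inr ?_⟩
  · haveI : Nonempty (RC.RealPart (baseRC Literature.AlgebraicGeometry.Frobenioids.ArchFrd.P35iiiStd.toD0)) := ⟨⟨a, realObjects_a⟩⟩
    refine zigzag_isConnected fun X Y => ?_
    obtain ⟨X, hX⟩ := X
    obtain ⟨Y, hY⟩ := Y
    obtain rfl := eq_a_of_realObjects hX
    obtain rfl := eq_a_of_realObjects hY
    exact Zigzag.refl _
  · haveI : Nonempty (RC.ComplexPart (baseRC Literature.AlgebraicGeometry.Frobenioids.ArchFrd.P35iiiStd.toD0)) := ⟨⟨b, complexObjects_b⟩⟩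
    -- every complex object is reached from `d` inside `S[ℂ]`
    have hd : ∀ Y : RC.ComplexPart (baseRC Literature.AlgebraicGeometry.Frobenioids.ArchFrd.P35iiiStd.toD0), Zigzag (⟨d, complexObjects_d⟩ : RC.ComplexPart (baseRC Literature.AlgebraicGeometry.Frobenioids.ArchFrd.P35iiiStd.toD0)) Y := by
      rintro ⟨Y, hY⟩
      cases Y
      · exact absurd hY not_complexObjects_a
      · exact Zigzag.of_hom (ObjectProperty.homMk (pHom false))
      · exact Zigzag.of_hom (ObjectProperty.homMk (qHom false))
      · exact Zigzag.refl _
    exact zigzag_isConnected fun X Y => (hd X).symm.trans (hd Y)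

/-- **`S` with `π = toD0` is of RC-STANDARD type** ([FrdII] Def. 3.1 (v) (a)–(d) for the totally epimorphic
category `S`) — ALL the standing hypotheses on the base `D` in [FrdII] Thm. 3.6 and Cor. 4.2 (v).
[cite: MochizukiFrdII2008, Def 3.1 (v) p.25] -/
theorem isOfRCStandardType : RC.IsOfRCStandardType (baseRC Literature.AlgebraicGeometry.Frobenioids.ArchFrd.P35iiiStd.toD0) :=
  ⟨isTotallyEpimorphic, isRCConnected, isComplexifiable, isOfFSMFFType, isOfRCIsoSubanchorType⟩

end P35iiiStd

end ArchFrd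

end

end Literature.AlgebraicGeometry.Frobenioids
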